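import Mathlib
import HarnessLib
import Literature.RingTheory.Valuation.GabberRameroCotangent
import Summits.ResolutionOfSingularities.ResolutionOfSingularities.Theses.IndSmooth

/-!
# Route IndSmooth — support `CotangentShadow` (stmt-ResolutionOfSingularities-16091) from the
Gabber–Ramero named facts (CONDITIONAL result)

Kill test K4.4, s-part (RESCUE-SEED slot W4.4: «IndSmooth's `CotangentShadow` (Gabber–Ramero, proved
in print) typed as a positive rung»; seat res-L0-k44). The support item `CotangentShadow` of
`Summits/ResolutionOfSingularities/ResolutionOfSingularities/Theses/IndSmooth.lean` is, verbatim over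
Mathlib, the conjunction of two theorems in print: Gabber–Ramero, *Almost Ring Theory* (LNM 1800, 2003),
Theorem 6.5.12 (ii) (special case: trivially valued perfect ground field, degree 1) and Corollary 6.5.21
(the `Ω` half), both already typed as NAMED FACTS in
`Literature/RingTheory/Valuation/GabberRameroCotangent.lean` together with the proved glue
`Literature.RingTheory.Valuation.cotangentShadow_of_gabberRamero`. This file records the Summits-side
link: the route decl follows from the two facts. It is CONDITIONAL on them (hypotheses `h1`, `h2`);
the item closes only when the facts are discharged (Gabber–Ramero's proof: GR Prop. 6.5.9, Thm. 6.3.32,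
transitivity — sizeable Literature work, not attempted here). Everything here is OURS bookkeeping on an
EXISTING route; nothing is a statement of Hironaka's manuscript.
-/

set_option linter.dupNamespace false

namespace Summit.ResolutionOfSingularities.ResolutionOfSingularities.Theorems

open Literature.RingTheory.Valuation

/-- **`CotangentShadow` from Gabber–Ramero (conditional).** Assuming the named facts
`GabberRamero2003_thm_6_5_12_ii` (for a perfect field `k` and a valuation subring `O ∋ k` of a field,
`H_1(𝕃_{O/k}) = 0`) and `GabberRamero2003_cor_6_5_21` (`Ω[O⁄k]` is a torsion-free `O`-module), the
route decl `IndSmooth.CotangentShadow` holds: for `k` perfect of characteristic `p` and any valuation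
subring `O ⊇ k` of a field `K ⊇ k`, `Ω[O⁄k]` is flat over `O` (torsion-free over a Bézout domain,
Mathlib `Module.Flat.flat_iff_torsion_eq_bot_of_isBezout`) and `H_1(𝕃_{O/k}) = 0`.
[cite: GabberRamero2003, Thm 6.5.12(ii), Cor 6.5.21] -/
theorem cotangentShadow_of_gabberRamero_facts
    (h1 : GabberRamero2003_thm_6_5_12_ii.{0, 0}) (h2 : GabberRamero2003_cor_6_5_21.{0, 0}) :
    Theses.IndSmooth.CotangentShadow := by
  unfold Theses.IndSmooth.CotangentShadow
  exact cotangentShadow_of_gabberRamero h1 h2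

end Summit.ResolutionOfSingularities.ResolutionOfSingularities.Theorems
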